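import Summits.HodgeConjecture.HodgeConjecture.Theorems.FermatSurfaceSeparationClosures

/-!
# Exotic Hodge pairs on Fermat squares, IV — uniform exotic pairs (families E, T, F) and THE SEPARATION LAW `FermatSep m ↔ FermatSepCriterion m`

Part 4 of 4 (Sketch §3 `section UniformExoticPairs` + `section SeparationLaw`, ll. 685–1002). Three one-parameter families of exotic
Hodge pairs, each an explicit `4 + 4` splitting of a standard Hodge octuple: FAMILY E (`m = 2h ≥ 10`, from Shioda's `α₁`):
`(1, h+1, 2, h−4) ~ (h, 2, 2, h−4)`; FAMILY T (`m = 3j ≥ 9`, from `σ_{3,1}`): `(1, j+1, 2, 2j−4) ~ (3, j−1, 2, 2j−4)`; FAMILY F (`m = 5j ≥ 15`,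
from `σ_{5,1}`): `(1, j+1, 2j+1, 2j−3) ~ (2j−1, j−1, 5, 2j−3)`; plus the finite checks `m = 6, 8`. Hence `not_fermatSep_of_not_criterion :
2 ≤ m → ¬ FermatSepCriterion m → ¬ FermatSep m`, and with Part 3 **THE SEPARATION LAW** `fermatSep_iff_fermatSepCriterion :
2 ≤ m → (FermatSep m ↔ FermatSepCriterion m)` — the Fermat surface `X²ₘ` has no exotic Hodge pairs iff `m` is prime, or `m = 4`, or `m` is
odd with all prime factors `≥ 7` (= conjecture EXO-2 recorded in the docstring of `FermatSepCriterion`, census-verified for `m ≤ 120` in memo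
ROUTE-P1AD and now a theorem for all `m ≥ 2`); `fermatSepConjecture_holds`, `separationLaw_instances` (worked degrees).
Literature status (cell lit seat g20, LIT-DOSSIER §81): the weight-2 separation law and the families E∕T∕F are NOT IN PRINT; weight-1 precedent
Aoki, Amer. J. Math. 113 (1991) ∕ Koblitz–Rohrlich, Canad. J. Math. 30 (1978).

PROVENANCE. Cell hodge-nonav (HUMAN RULING D-0038), planner seat p1: chapters ROUTE-P1AE §B (g32) and ROUTE-P1AF + ADD (g33),
frozen Sketch `HOME/p1/route/Sketch_P1AF_ADD_SEPLAW_g33.lean` (sha16 9c70bd8d356ffb70, 1004 lines, namespace `HodgeNonAV.P1AF`,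
farm rc 0 / 0 sorries / axioms {propext, Classical.choice, Quot.sound}; referee PASS: REF-P1AF b32cd9c28a7cc495), split into
four tree modules `FermatSurfaceSeparationCriterion` → `…Sigma` → `…Closures` → `FermatSurfaceSeparationLaw` by planner p1 g34
(landing kit HOME/p1/landing/, 2026-08-28); bodies verbatim, namespace moved to that of `Theorems/FermatSurfaceExoticPairsDefs`.
Land with `--supports stmt-HodgeConjecture-19652 --as helper` (K6 ∕ evidence carrier of the non-AV index) or `--supports
stmt-HodgeConjecture-1334` (the Fermat line whose engines §2 consumes). No instance, no notation, no sorry, no new axiom.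
HONEST SCOPE: combinatorics of Shioda's Hodge-character semigroup of Fermat surfaces and sixfolds; NOTHING here proves the
Hodge conjecture or HC for any new variety — `FermatSep m` is the INPUT half of `HC⁴(X²ₘ × X²ₘ)` via the landed SQ-AUT theorem
`PgOneCyclotomicSquares.hodgeConjectureFor_square_of_endomorphisms`, and those squares are dominated by Fermat/abelian motives anyway.
References: N. Aoki, Math. Ann. 266 (1983) Thm A, §1 (𝔇ⁿₘ), §5 Thm D, Prop. 6.4/6.6, Lemma 7.3 [cite: Aoki1983, Thm. A];
N. Aoki, J. Math. Soc. Japan 39 (1987) Thm 2-1 [cite: Aoki1987, Thm. 2-1]; N. Aoki, Comment. Math. Univ. St. Pauli 49 (2000) Lemma 4.1;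
T. Shioda, Math. Ann. 245 (1979) Thm I–IV [cite: Shioda1979PJA, Thm. I]; Z. Ran, Compositio Math. 42 (1980) Prop. 1.8 [cite: Ran1980, Prop. 1.8];
G. da Silva Jr., arXiv:2101.04739 (2021) Thm 2.1–2.2, Prop. 3.1 [cite: daSilva2021HodgeFermat, Thm. 2.1].
-/

set_option linter.dupNamespace false

noncomputable section

namespace Summit.HodgeConjecture.HodgeConjecture.Theorems.FermatSurfaceExoticPairs

open Multiset Literature.AlgebraicGeometry.HodgeTheory.FermatCharacter

variable {m : ℕ}

/-! ## §3 (ADD, g33) — EXO-3 «⟹»: UNIFORM EXOTIC PAIRS, and the separation law as a THEOREM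

Three one-parameter families of exotic Hodge pairs, each an explicit `4 + 4` splitting of a standard Hodge octuple
`(standard quadruple or sextuple) ⊎ (pairs)`:
* FAMILY E (`m = 2h`, `h ≥ 5`):  `(1, h+1, 2, h−4) ~ (h, 2, 2, h−4)`,        octuple `α₁ ⊎ {±2} ⊎ {±(h−4)}`  (Shioda's `α₁`);
* FAMILY T (`m = 3j`, `j ≥ 3`):  `(1, j+1, 2, 2j−4) ~ (3, j−1, 2, 2j−4)`,     octuple `σ_{3,1} ⊎ {±2} ⊎ {±(2j−4)}`;
* FAMILY F (`m = 5j`, `j ≥ 3`):  `(1, j+1, 2j+1, 2j−3) ~ (2j−1, j−1, 5, 2j−3)`, octuple `σ_{5,1} ⊎ {±(2j−3)}`;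
plus the finite checks `m = 6, 8`.  In each family both quadruples have `Σ⟨·⟩ = m` at `t = 1` (type `(2,0)+(0,2)`: transcendental)
and differ (`h+1`, resp. `1`, lies in `u ∖ w`).  Consequence: `¬ FermatSepCriterion m → ¬ FermatSep m` for every `m ≥ 2`, and with
§2 (`fermatSep_of_fermatSepCriterion`) the separation law **`FermatSep m ↔ FermatSepCriterion m` (all `m ≥ 2`) is a theorem**
(`fermatSep_iff_fermatSepCriterion`, `fermatSepConjecture_holds`) — conjecture EXO-2 of ROUTE-P1AD §B / the `FermatSepCriterion`
docstring of `Theorems/FermatSurfaceExoticPairsDefs`, previously census-verified for `m ≤ 120` only. -/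

section UniformExoticPairs

open Literature.AlgebraicGeometry.Shioda1982

variable {m : ℕ}

/-- A quadruple literal is the sum of its four singletons. [folklore] -/
theorem quad_eq_add (a b c d : ZMod m) :
    ({a, b, c, d} : Multiset (ZMod m)) = {a} + ({b} + ({c} + {d})) := by
  simp only [insert_eq_cons, singleton_add]

/-- A pair literal is the sum of its two singletons. [folklore] -/
theorem pair_eq_add (a b : ZMod m) : ({a, b} : Multiset (ZMod m)) = {a} + {b} := by
  simp only [insert_eq_cons, singleton_add]

/-- `negM` of a quadruple literal. [folklore] -/
theorem negM_quad (a b c d : ZMod m) :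
    negM ({a, b, c, d} : Multiset (ZMod m)) = {-a, -b, -c, -d} := by
  simp only [negM, insert_eq_cons, map_cons, map_singleton]

/-- A natural number `0 < n < m` is a non-zero residue. [folklore] -/
theorem natCast_ne_zero_of_lt [NeZero m] {n : ℕ} (h0 : 0 < n) (hn : n < m) : ((n : ℕ) : ZMod m) ≠ 0 := by
  intro h
  have hd := (ZMod.natCast_eq_zero_iff _ _).1 h
  exact absurd (Nat.le_of_dvd h0 hd) (by omega)

/-- `val` of a small natural cast. [folklore] -/
theorem val_natCast_of_lt' {n : ℕ} (hn : n < m) : (((n : ℕ) : ZMod m)).val = n := by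
  rw [ZMod.val_natCast, Nat.mod_eq_of_lt hn]

/-- Two small natural casts are equal only if the naturals are. [folklore] -/
theorem natCast_inj_of_lt {a b : ℕ} (ha : a < m) (hb : b < m) (h : ((a : ℕ) : ZMod m) = b) : a = b := by
  have := congrArg ZMod.val h
  rwa [val_natCast_of_lt' ha, val_natCast_of_lt' hb] at this

/-- TRANSCENDENTAL QUADRUPLE CRITERION: four residues `0 < a, b, c, d < m` with `a + b + c + d = m` (so Hodge type `(2,0) + (0,2)`
at `t = 1`: `Σ⟨·⟩ = m ≠ 2m`) form a transcendental character of `X²ₘ`. [cite: Shioda1979PJA, §1 eq. (2)] -/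
theorem isTransQuad_natCast [NeZero m] {a b c d : ℕ} (ha : 0 < a) (hb : 0 < b) (hc : 0 < c) (hd : 0 < d)
    (hsum : a + b + c + d = m) :
    IsTransQuad ({((a : ℕ) : ZMod m), ((b : ℕ) : ZMod m), ((c : ℕ) : ZMod m), ((d : ℕ) : ZMod m)} : Multiset (ZMod m)) := by
  have ham : a < m := by omega
  have hbm : b < m := by omega
  have hcm : c < m := by omega
  have hdm : d < m := by omega
  refine ⟨by simp, ?_, ?_, ?_⟩
  · intro x hx
    simp only [insert_eq_cons, mem_cons, mem_singleton] at hx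
    rcases hx with rfl | rfl | rfl | rfl
    · exact natCast_ne_zero_of_lt ha ham
    · exact natCast_ne_zero_of_lt hb hbm
    · exact natCast_ne_zero_of_lt hc hcm
    · exact natCast_ne_zero_of_lt hd hdm
  · have h : (((a + b + c + d : ℕ)) : ZMod m) = 0 := by rw [hsum]; exact ZMod.natCast_self m
    push_cast at h
    simpa [insert_eq_cons, add_assoc] using h
  · intro hH
    have h1 := hH.2 1
    simp only [Units.val_one, one_mul, map_id', insert_eq_cons, card_cons, card_singleton] at h1
    simp only [mNormSum, map_cons, map_singleton, sum_cons, sum_singleton, val_natCast_of_lt' ham,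
      val_natCast_of_lt' hbm, val_natCast_of_lt' hcm, val_natCast_of_lt' hdm] at h1
    omega

/-- An exotic pair refutes separation. [cell hodge-nonav memo ROUTE-P1AD §B] -/
theorem not_fermatSep_of_isExoticPair' {u w : Multiset (ZMod m)} (h : IsExoticPair u w) : ¬ FermatSep m :=
  fun hs ↦ h.2 (hs u w h.1)

/-! ### Family E (even degrees `m = 2h ≥ 10`): `(1, h+1, 2, h−4) ~ (h, 2, 2, h−4)`,
octuple `= α₁ ⊎ {2,−2} ⊎ {h−4, −(h−4)}` with Shioda's `α₁ = stdOne = {1, h, h+1, −2}`. -/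

/-- FAMILY E: for every `h ≥ 5` the Fermat surface of degree `m = 2h` carries the exotic pair `u = (1, h+1, 2, h−4)`,
`w = (h, 2, 2, h−4)`: `u ∗ (−w) = α₁ + {2, −2} + {h−4, 4−h}` is Hodge (Shioda 1982 Lemma 1 (a)), `u`, `w` are transcendental
(`Σ⟨·⟩ = m` at `t = 1`) and `h + 1 ∈ u ∖ w`. [this memo, ROUTE-P1AF-ADD §A; cite: Shioda1982PicardFermat, Lemma 1 (a) p. 728] -/
theorem not_fermatSep_two_mul {h : ℕ} (hh : 5 ≤ h) : ¬ FermatSep (2 * h) := by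
  haveI : NeZero (2 * h) := ⟨by omega⟩
  set m : ℕ := 2 * h with hm_def
  have hK : m / 2 = h := by rw [hm_def]; omega
  have hhm : ((h : ℕ) : ZMod m) + h = 0 := by
    rw [← Nat.cast_add, ← two_mul, ← hm_def]; exact ZMod.natCast_self m
  have hneg_h : -((h : ℕ) : ZMod m) = h := neg_eq_of_add_eq_zero_left hhm
  have h2K : 2 * ((h : ℕ) : ZMod m) - 2 = -2 := by rw [two_mul, hhm, zero_sub]
  have h2ne : ((2 : ℕ) : ZMod m) ≠ 0 := natCast_ne_zero_of_lt (by norm_num) (by omega)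
  have hx : ((h - 4 : ℕ) : ZMod m) ≠ 0 := natCast_ne_zero_of_lt (by omega) (by omega)
  refine not_fermatSep_of_isExoticPair'
    (u := {((1 : ℕ) : ZMod m), ((h + 1 : ℕ) : ZMod m), ((2 : ℕ) : ZMod m), ((h - 4 : ℕ) : ZMod m)})
    (w := {((h : ℕ) : ZMod m), ((2 : ℕ) : ZMod m), ((2 : ℕ) : ZMod m), ((h - 4 : ℕ) : ZMod m)}) ⟨⟨?_, ?_, ?_⟩, ?_⟩
  · exact isTransQuad_natCast (by norm_num) (by omega) (by norm_num) (by omega) (by omega)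
  · exact isTransQuad_natCast (by omega) (by norm_num) (by norm_num) (by omega) (by omega)
  · -- the octuple is `stdOne m + {2,-2} + {h-4, -(h-4)}`
    have hstd := isHodgeMultiset_stdOne (m := m) ⟨h, hm_def⟩ (by omega)
    have hO : ({((1 : ℕ) : ZMod m), ((h + 1 : ℕ) : ZMod m), ((2 : ℕ) : ZMod m), ((h - 4 : ℕ) : ZMod m)} : Multiset (ZMod m)) +
        negM {((h : ℕ) : ZMod m), ((2 : ℕ) : ZMod m), ((2 : ℕ) : ZMod m), ((h - 4 : ℕ) : ZMod m)} =
        stdOne m + (({(2 : ZMod m), -2} : Multiset (ZMod m)) + {((h - 4 : ℕ) : ZMod m), -((h - 4 : ℕ) : ZMod m)}) := by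
      rw [negM_quad, stdOne, hK, quad_eq_add, quad_eq_add, quad_eq_add, pair_eq_add, pair_eq_add, hneg_h, h2K]
      push_cast
      abel
    rw [hO]
    exact hstd.add ((IsHodgeMultiset.pair (by exact_mod_cast h2ne)).add (IsHodgeMultiset.pair hx))
  · -- `u ≠ w`: `h + 1 ∈ u`, `h + 1 ∉ w`
    intro huw
    have hmem : ((h + 1 : ℕ) : ZMod m) ∈ ({((h : ℕ) : ZMod m), ((2 : ℕ) : ZMod m), ((2 : ℕ) : ZMod m), ((h - 4 : ℕ) : ZMod m)} :
        Multiset (ZMod m)) := by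
      rw [← huw]; simp
    simp only [insert_eq_cons, mem_cons, mem_singleton] at hmem
    rcases hmem with e | e | e | e
    · have := natCast_inj_of_lt (m := m) (by omega) (by omega) e; omega
    · have := natCast_inj_of_lt (m := m) (by omega) (by omega) e; omega
    · have := natCast_inj_of_lt (m := m) (by omega) (by omega) e; omega
    · have := natCast_inj_of_lt (m := m) (by omega) (by omega) e; omega

/-! ### Family T (degrees `m = 3j ≥ 9`): `(1, j+1, 2, 2j−4) ~ (3, j−1, 2, 2j−4)`,
octuple `= γ₁ ⊎ {2,−2} ⊎ {2j−4, −(2j−4)}` with Shioda's `γ₁ = stdThree = σ_{3,1} = {1, j+1, 2j+1, −3}`. -/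

/-- FAMILY T: for every `j ≥ 3` the Fermat surface of degree `m = 3j` carries the exotic pair `u = (1, j+1, 2, 2j−4)`,
`w = (3, j−1, 2, 2j−4)`: `u ∗ (−w) = σ_{3,1} + {2, −2} + {2j−4, 4−2j}` is Hodge (Aoki's standard element, Shioda 1982 Lemma 1 (b)),
`u`, `w` are transcendental and `1 ∈ u ∖ w`. [this memo, ROUTE-P1AF-ADD §A; cite: Shioda1982PicardFermat, Lemma 1 (b) p. 728]
[cite: Aoki1983, §5 Prop. 5.1 (p. 36)] -/
theorem not_fermatSep_three_mul {j : ℕ} (hj : 3 ≤ j) : ¬ FermatSep (3 * j) := by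
  haveI : NeZero (3 * j) := ⟨by omega⟩
  set m : ℕ := 3 * j with hm_def
  have hK : m / 3 = j := by rw [hm_def]; omega
  have h3J : 3 * ((j : ℕ) : ZMod m) = 0 := by
    have h : (((3 * j : ℕ)) : ZMod m) = 0 := by rw [← hm_def]; exact ZMod.natCast_self m
    push_cast at h
    exact h
  have e1 : -((j - 1 : ℕ) : ZMod m) = 2 * ((j : ℕ) : ZMod m) + 1 := by
    rw [Nat.cast_sub (by omega : 1 ≤ j)]; push_cast; linear_combination (-1 : ZMod m) * h3J
  have e2 : -((3 : ℕ) : ZMod m) = 3 * ((j : ℕ) : ZMod m) - 3 := by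
    push_cast; linear_combination (-1 : ZMod m) * h3J
  have h2ne : ((2 : ℕ) : ZMod m) ≠ 0 := natCast_ne_zero_of_lt (by norm_num) (by omega)
  have hx : ((2 * j - 4 : ℕ) : ZMod m) ≠ 0 := natCast_ne_zero_of_lt (by omega) (by omega)
  refine not_fermatSep_of_isExoticPair'
    (u := {((1 : ℕ) : ZMod m), ((j + 1 : ℕ) : ZMod m), ((2 : ℕ) : ZMod m), ((2 * j - 4 : ℕ) : ZMod m)})
    (w := {((3 : ℕ) : ZMod m), ((j - 1 : ℕ) : ZMod m), ((2 : ℕ) : ZMod m), ((2 * j - 4 : ℕ) : ZMod m)}) ⟨⟨?_, ?_, ?_⟩, ?_⟩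
  · exact isTransQuad_natCast (by norm_num) (by omega) (by norm_num) (by omega) (by omega)
  · exact isTransQuad_natCast (by norm_num) (by omega) (by norm_num) (by omega) (by omega)
  · have hstd := isHodgeMultiset_stdThree (m := m) ⟨j, hm_def⟩ (by omega)
    have hO : ({((1 : ℕ) : ZMod m), ((j + 1 : ℕ) : ZMod m), ((2 : ℕ) : ZMod m), ((2 * j - 4 : ℕ) : ZMod m)} : Multiset (ZMod m)) +
        negM {((3 : ℕ) : ZMod m), ((j - 1 : ℕ) : ZMod m), ((2 : ℕ) : ZMod m), ((2 * j - 4 : ℕ) : ZMod m)} =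
        stdThree m + (({(2 : ZMod m), -2} : Multiset (ZMod m)) + {((2 * j - 4 : ℕ) : ZMod m), -((2 * j - 4 : ℕ) : ZMod m)}) := by
      rw [negM_quad, stdThree, hK, quad_eq_add, quad_eq_add, quad_eq_add, pair_eq_add, pair_eq_add, e1, e2]
      push_cast
      abel
    rw [hO]
    exact hstd.add ((IsHodgeMultiset.pair (by exact_mod_cast h2ne)).add (IsHodgeMultiset.pair hx))
  · intro huw
    have hmem : ((1 : ℕ) : ZMod m) ∈ ({((3 : ℕ) : ZMod m), ((j - 1 : ℕ) : ZMod m), ((2 : ℕ) : ZMod m), ((2 * j - 4 : ℕ) : ZMod m)} :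
        Multiset (ZMod m)) := by
      rw [← huw]; simp
    simp only [insert_eq_cons, mem_cons, mem_singleton] at hmem
    rcases hmem with e | e | e | e
    · have := natCast_inj_of_lt (m := m) (by omega) (by omega) e; omega
    · have := natCast_inj_of_lt (m := m) (by omega) (by omega) e; omega
    · have := natCast_inj_of_lt (m := m) (by omega) (by omega) e; omega
    · have := natCast_inj_of_lt (m := m) (by omega) (by omega) e; omega

/-! ### Family F (degrees `m = 5j ≥ 15`): `(1, j+1, 2j+1, 2j−3) ~ (2j−1, j−1, 5, 2j−3)`,
octuple `= σ_{5,1} ⊎ {2j−3, −(2j−3)}` with Aoki's standard sextuple `σ_{5,1} = {1, 1+j, 1+2j, 1+3j, 1+4j, −5}`. -/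

/-- FAMILY F: for every `j ≥ 3` the Fermat surface of degree `m = 5j` carries the exotic pair `u = (1, j+1, 2j+1, 2j−3)`,
`w = (2j−1, j−1, 5, 2j−3)`: `u ∗ (−w) = σ_{5,1} + {2j−3, 3−2j}` is Hodge (Aoki 1983 Prop. 5.1), `u`, `w` are transcendental and
`1 ∈ u ∖ w`. [this memo, ROUTE-P1AF-ADD §A; cite: Aoki1983, §5 Prop. 5.1 (p. 36)] [cite: Aoki1987, §1 p. 387] -/
theorem not_fermatSep_five_mul {j : ℕ} (hj : 3 ≤ j) : ¬ FermatSep (5 * j) := by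
  haveI : NeZero (5 * j) := ⟨by omega⟩
  set m : ℕ := 5 * j with hm_def
  have hK : m / 5 = j := by rw [hm_def]; omega
  have h5J : 5 * ((j : ℕ) : ZMod m) = 0 := by
    have h : (((5 * j : ℕ)) : ZMod m) = 0 := by rw [← hm_def]; exact ZMod.natCast_self m
    push_cast at h
    exact h
  have e1 : -((2 * j - 1 : ℕ) : ZMod m) = 1 + ((3 : ℕ) : ZMod m) * ((j : ℕ) : ZMod m) := by
    rw [Nat.cast_sub (by omega : 1 ≤ 2 * j)]; push_cast; linear_combination (-1 : ZMod m) * h5J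
  have e2 : -((j - 1 : ℕ) : ZMod m) = 1 + ((4 : ℕ) : ZMod m) * ((j : ℕ) : ZMod m) := by
    rw [Nat.cast_sub (by omega : 1 ≤ j)]; push_cast; linear_combination (-1 : ZMod m) * h5J
  have e3 : -((5 : ℕ) : ZMod m) = -(((5 : ℕ) : ZMod m) * 1) := by rw [mul_one]
  have e4 : 1 + ((0 : ℕ) : ZMod m) * ((j : ℕ) : ZMod m) = ((1 : ℕ) : ZMod m) := by push_cast; ring
  have e5 : ((j + 1 : ℕ) : ZMod m) = 1 + ((1 : ℕ) : ZMod m) * ((j : ℕ) : ZMod m) := by push_cast; ring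
  have e6 : ((2 * j + 1 : ℕ) : ZMod m) = 1 + ((2 : ℕ) : ZMod m) * ((j : ℕ) : ZMod m) := by push_cast; ring
  have h5a : ((5 : ℕ) : ZMod m) * 1 ≠ 0 := by
    rw [mul_one]; exact natCast_ne_zero_of_lt (by norm_num) (by omega)
  have hx : ((2 * j - 3 : ℕ) : ZMod m) ≠ 0 := natCast_ne_zero_of_lt (by omega) (by omega)
  refine not_fermatSep_of_isExoticPair'
    (u := {((1 : ℕ) : ZMod m), ((j + 1 : ℕ) : ZMod m), ((2 * j + 1 : ℕ) : ZMod m), ((2 * j - 3 : ℕ) : ZMod m)})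
    (w := {((2 * j - 1 : ℕ) : ZMod m), ((j - 1 : ℕ) : ZMod m), ((5 : ℕ) : ZMod m), ((2 * j - 3 : ℕ) : ZMod m)}) ⟨⟨?_, ?_, ?_⟩, ?_⟩
  · exact isTransQuad_natCast (by norm_num) (by omega) (by omega) (by omega) (by omega)
  · exact isTransQuad_natCast (by omega) (by omega) (by norm_num) (by omega) (by omega)
  · have hstd := isHodgeMultiset_pStandard (m := m) (p := 5) (r := 2) rfl ⟨j, hm_def⟩ (a := 1) h5a
    rw [hK, show (Multiset.range 5) = {0, 1, 2, 3, 4} from by decide] at hstd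
    simp only [insert_eq_cons, map_cons, map_singleton] at hstd
    have hO : ({((1 : ℕ) : ZMod m), ((j + 1 : ℕ) : ZMod m), ((2 * j + 1 : ℕ) : ZMod m), ((2 * j - 3 : ℕ) : ZMod m)} : Multiset (ZMod m)) +
        negM {((2 * j - 1 : ℕ) : ZMod m), ((j - 1 : ℕ) : ZMod m), ((5 : ℕ) : ZMod m), ((2 * j - 3 : ℕ) : ZMod m)} =
        ((1 + ((0 : ℕ) : ZMod m) * ((j : ℕ) : ZMod m)) ::ₘ (1 + ((1 : ℕ) : ZMod m) * ((j : ℕ) : ZMod m)) ::ₘ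
          (1 + ((2 : ℕ) : ZMod m) * ((j : ℕ) : ZMod m)) ::ₘ (1 + ((3 : ℕ) : ZMod m) * ((j : ℕ) : ZMod m)) ::ₘ
          {1 + ((4 : ℕ) : ZMod m) * ((j : ℕ) : ZMod m)} + {-(((5 : ℕ) : ZMod m) * 1)}) +
        {((2 * j - 3 : ℕ) : ZMod m), -((2 * j - 3 : ℕ) : ZMod m)} := by
      rw [negM_quad, e1, e2, e3, e4, e5, e6, quad_eq_add, quad_eq_add, pair_eq_add]
      simp only [← singleton_add]
      abel
    rw [hO]
    exact hstd.add (IsHodgeMultiset.pair hx)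
  · intro huw
    have hmem : ((1 : ℕ) : ZMod m) ∈ ({((2 * j - 1 : ℕ) : ZMod m), ((j - 1 : ℕ) : ZMod m), ((5 : ℕ) : ZMod m), ((2 * j - 3 : ℕ) : ZMod m)} :
        Multiset (ZMod m)) := by
      rw [← huw]; simp
    simp only [insert_eq_cons, mem_cons, mem_singleton] at hmem
    rcases hmem with e | e | e | e
    · have := natCast_inj_of_lt (m := m) (by omega) (by omega) e; omega
    · have := natCast_inj_of_lt (m := m) (by omega) (by omega) e; omega
    · have := natCast_inj_of_lt (m := m) (by omega) (by omega) e; omega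
    · have := natCast_inj_of_lt (m := m) (by omega) (by omega) e; omega

/-! ### The two smallest even degrees (finite check) -/

/-- m = 6: `(1,1,1,3) ~ (1,1,2,2)` (duplication identity). [cite: Shioda1979PJA, §2 Thm. 1] [cell hodge-nonav memo ROUTE-P1AD §C] -/
theorem not_fermatSep_6' : ¬ FermatSep 6 :=
  not_fermatSep_of_isExoticPair' (u := {1, 1, 1, 3}) (w := {1, 1, 2, 2})
    (by unfold IsExoticPair IsHodgePair IsTransQuad negM; decide +kernel)

/-- m = 8: `(1,1,1,5) ~ (1,1,2,4)`. [cell hodge-nonav memo ROUTE-P1AD §C] -/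
theorem not_fermatSep_8' : ¬ FermatSep 8 :=
  not_fermatSep_of_isExoticPair' (u := {1, 1, 1, 5}) (w := {1, 1, 2, 4})
    (by unfold IsExoticPair IsHodgePair IsTransQuad negM; decide +kernel)

/-! ### EXO-3 «⟹»: every degree outside the criterion has an exotic pair -/

/-- **EXO-3, direction «⟹» (THEOREM).** If `m ≥ 2` is composite, `m ≠ 4`, and `m` is even or has a prime factor `3` or `5`
(i.e. `¬ FermatSepCriterion m`), then `X²ₘ` carries an exotic Hodge pair: `m = 6, 8` by the finite check, even `m ≥ 10` by FAMILY E,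
odd `3 ∣ m` by FAMILY T (`m = 3j`, `j ≥ 3` odd), odd `5 ∣ m`, `3 ∤ m` by FAMILY F (`m = 5j`, `j ≥ 3`). [this memo, ROUTE-P1AF-ADD §A] -/
theorem not_fermatSep_of_not_criterion (h2 : 2 ≤ m) (hc : ¬ FermatSepCriterion m) : ¬ FermatSep m := by
  unfold FermatSepCriterion at hc
  push Not at hc
  obtain ⟨hnp, h4, hodd⟩ := hc
  rcases Nat.even_or_odd m with he | ho
  · obtain ⟨h, hh⟩ := he
    have hm : m = 2 * h := by omega
    subst hm
    rcases (show h ≤ 1 ∨ h = 2 ∨ h = 3 ∨ h = 4 ∨ 5 ≤ h by omega) with h1 | rfl | rfl | rfl | h5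
    · have : h = 1 := by omega
      subst this
      exact absurd Nat.prime_two hnp
    · exact absurd rfl h4
    · exact not_fermatSep_6'
    · exact not_fermatSep_8'
    · exact not_fermatSep_two_mul h5
  · obtain ⟨p, hp, hpm, hp7⟩ := hodd ho
    have hp2 := hp.two_le
    interval_cases p
    · exact absurd (even_iff_two_dvd.mpr hpm) (Nat.not_even_iff_odd.mpr ho)
    · obtain ⟨j, rfl⟩ := hpm
      rcases (show j ≤ 2 ∨ 3 ≤ j by omega) with hj | hj
      · interval_cases j
        · omega
        · exact absurd Nat.prime_three hnp
        · exact absurd ho (by decide)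
      · exact not_fermatSep_three_mul hj
    · exact absurd hp (by decide)
    · obtain ⟨j, rfl⟩ := hpm
      rcases (show j ≤ 2 ∨ 3 ≤ j by omega) with hj | hj
      · interval_cases j
        · omega
        · exact absurd hp hnp
        · exact absurd ho (by decide)
      · exact not_fermatSep_five_mul hj
    · exact absurd hp (by decide)

end UniformExoticPairs

section SeparationLaw

variable {m : ℕ}

/-- **THE SEPARATION LAW (EXO-2 ∕ EXO-3) — THEOREM.** For every `m ≥ 2`: the Fermat surface `X²ₘ` has no exotic Hodge pairs
(every Hodge pair on `X²ₘ × X²ₘ` is a coordinate permutation) **iff** `m` is prime, or `m = 4`, or `m` is odd with all prime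
factors `≥ 7`.  «⟸»: §2 (`fermatSep_of_fermatSepCriterion`: primes by `fermatSep_prime`, `4` by the finite check, the odd case by the
tree's reach/pairing engines + Aoki's Theorem A); «⟹»: §3 (families E, T, F + `m = 6, 8`). [this memo, ROUTE-P1AF-ADD §A] -/
theorem fermatSep_iff_fermatSepCriterion (h2 : 2 ≤ m) : FermatSep m ↔ FermatSepCriterion m :=
  ⟨fun hs ↦ by_contra fun hc ↦ not_fermatSep_of_not_criterion h2 hc hs, fermatSep_of_fermatSepCriterion (by omega)⟩

/-- The conjecture `FermatSepConjecture` of ROUTE-P1AD §B (`∀ m ≥ 2, FermatSep m ↔ FermatSepCriterion m`) holds. [this memo, ROUTE-P1AF-ADD §A] -/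
theorem fermatSepConjecture_holds : ∀ m : ℕ, 2 ≤ m → (FermatSep m ↔ FermatSepCriterion m) :=
  fun _ h2 ↦ fermatSep_iff_fermatSepCriterion h2

/-- Instances beyond the census range `m ≤ 120` of ROUTE-P1AD: `X²₁₂₁`, `X²₁₄₃ = X²_{11·13}`, `X²₁₆₉` are separated;
`X²₂₆₂`, `X²₃₃₃`, `X²₅₅₅` are not. [this memo, ROUTE-P1AF-ADD §A] -/
theorem separationLaw_instances :
    FermatSep 121 ∧ FermatSep 143 ∧ FermatSep 169 ∧ ¬ FermatSep 262 ∧ ¬ FermatSep 333 ∧ ¬ FermatSep 555 := by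
  refine ⟨(fermatSep_iff_fermatSepCriterion (by norm_num)).2 (Or.inr (Or.inr ⟨by decide, fun p hp hpm ↦ ?_⟩)),
    (fermatSep_iff_fermatSepCriterion (by norm_num)).2 (Or.inr (Or.inr ⟨by decide, fun p hp hpm ↦ ?_⟩)),
    (fermatSep_iff_fermatSepCriterion (by norm_num)).2 (Or.inr (Or.inr ⟨by decide, fun p hp hpm ↦ ?_⟩)),
    not_fermatSep_two_mul (h := 131) (by norm_num), not_fermatSep_three_mul (j := 111) (by norm_num),
    not_fermatSep_five_mul (j := 111) (by norm_num)⟩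
  · -- 121 = 11²
    have h := (Nat.Prime.dvd_mul hp).1 (show p ∣ 11 * 11 from hpm)
    rcases h with h | h <;>
    · have := (Nat.prime_dvd_prime_iff_eq hp (by norm_num)).1 h; omega
  · -- 143 = 11 · 13
    have h := (Nat.Prime.dvd_mul hp).1 (show p ∣ 11 * 13 from hpm)
    rcases h with h | h
    · have := (Nat.prime_dvd_prime_iff_eq hp (by norm_num)).1 h; omega
    · have := (Nat.prime_dvd_prime_iff_eq hp (by norm_num)).1 h; omega
  · -- 169 = 13²
    have h := (Nat.Prime.dvd_mul hp).1 (show p ∣ 13 * 13 from hpm)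
    rcases h with h | h <;>
    · have := (Nat.prime_dvd_prime_iff_eq hp (by norm_num)).1 h; omega

end SeparationLaw

end Summit.HodgeConjecture.HodgeConjecture.Theorems.FermatSurfaceExoticPairs

end
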